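import Mathlib
import Literature.Probability.LatticeModels.ProdBernoulliIndependence
import Literature.Probability.Percolation.ConditionalPositiveAssociation
import Literature.Probability.Percolation.ConditionalPositiveAssociationProofs
import Literature.Probability.Percolation.TwoClusterConditionalAssociation
import Literature.Probability.Percolation.PercolationProofs
import Literature.Probability.Percolation.ClusterBoundary
import HarnessLib

/-!
# Crux `PercNearOneGluing.NearOneGluing` (stmt-CriticalPhenomena-4574), line `bhk-dyadic-thinning` — sub-goal `nearOneGluing_of_pocketSupport`

Helper file for the crux (lead prover-line-stmt-CriticalPhenomena-4574-0, wave 2): tooling / partial result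
for the residual `stub_doomWindow`.  Proves exactly the registered sub-goal signature; lands with
`--supports stmt-CriticalPhenomena-4574`.
-/

namespace Summit.CriticalPhenomena.PercolationContinuityZ3.Theorems

open scoped BigOperators Classical
open MeasureTheory Set
open Literature.Probability.LatticeModels (prodBernoulli)
open Literature.Probability.Percolation (openConn openConnIn openCluster measurableSet_openConn_holds)

/-- Elementary bookkeeping for the pocket sum: if `p ≥ 0`, `q ≤ 1` and `t ≥ 0`, then
`∑ᵢ min (p i) (t * q i)` is at most `t` times the number of indices with `p i > 0`
(terms with `p i = 0` vanish through the `min`, the others are at most `t * q i ≤ t`). -/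
theorem nearOneGluing_of_pocketSupport_sum_min_le {ι : Type*} (s : Finset ι) (p q : ι → ℝ) (t : ℝ)
    (ht : 0 ≤ t) (hp : ∀ i, 0 ≤ p i) (hq : ∀ i, q i ≤ 1) :
    ∑ i ∈ s, min (p i) (t * q i) ≤ ((s.filter fun i => 0 < p i).card : ℝ) * t := by
  calc ∑ i ∈ s, min (p i) (t * q i) ≤ ∑ i ∈ s, (if 0 < p i then t else 0) := by
        refine Finset.sum_le_sum fun i _ => ?_
        split_ifs with h
        · exact (min_le_right _ _).trans (mul_le_of_le_one_right ht (hq i))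
        · have h0 : p i = 0 := le_antisymm (not_lt.1 h) (hp i)
          exact (min_le_left _ _).trans h0.le
    _ = ∑ i ∈ s.filter (fun i => 0 < p i), t := (Finset.sum_filter _ _).symm
    _ = ((s.filter fun i => 0 < p i).card : ℝ) * t := by rw [Finset.sum_const, nsmul_eq_mul]

/-- Corollary of the pocket bound (lead, 2026-08-16): Kozma–Nitzan Conjecture 3 holds UNIFORMLY over all instances whose relay-free pocket `C_{V∖A}(o)` has at most `K` shapes of positive probability, with `δ = ε/(K+2)` — generalises KN Theorems 4–5 (K = 1, 2). Takes the pocket bound as hypothesis. [folklore] -/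
theorem nearOneGluing_of_pocketSupport :
    (∀ (n : ℕ) (w : Sym2 (Fin n) → unitInterval) (A : Finset (Fin n)) (o b : Fin n) (t : ℝ),
      0 ≤ t → o ∉ A →
      (∀ a ∈ A, (Literature.Probability.LatticeModels.prodBernoulli w).real
          (Literature.Probability.Percolation.openConn a b)ᶜ ≤ t) →
      (Literature.Probability.LatticeModels.prodBernoulli w).real
          ((⋃ a ∈ A, Literature.Probability.Percolation.openConn o a) ∩
            (Literature.Probability.Percolation.openConn o b)ᶜ) ≤
        ∑ S₀ ∈ (Finset.univ : Finset (Finset (Fin n))).filter (fun S₀ => o ∈ S₀ ∧ Disjoint S₀ A),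
          min ((Literature.Probability.LatticeModels.prodBernoulli w).real
                {ω | ∀ v : Fin n, ω ∈ Literature.Probability.Percolation.openConnIn (↑A)ᶜ o v ↔ v ∈ S₀})
              (t * (Literature.Probability.LatticeModels.prodBernoulli w).real
                {ω | ∀ v ∈ S₀, ω ∈ Literature.Probability.Percolation.openConnIn ↑S₀ o v})) →
    ∀ ε : ℝ, 0 < ε → ∀ K : ℕ, ∃ δ : ℝ, 0 < δ ∧
      ∀ (n : ℕ) (w : Sym2 (Fin n) → unitInterval) (A : Finset (Fin n)) (o b : Fin n),
        ((Finset.univ : Finset (Finset (Fin n))).filter (fun S₀ => o ∈ S₀ ∧ Disjoint S₀ A ∧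
            0 < (Literature.Probability.LatticeModels.prodBernoulli w).real
              {ω | ∀ v : Fin n, ω ∈ Literature.Probability.Percolation.openConnIn (↑A)ᶜ o v ↔ v ∈ S₀})).card
          ≤ K →
        1 - δ < (Literature.Probability.LatticeModels.prodBernoulli w).real
            (⋃ a ∈ A, Literature.Probability.Percolation.openConn o a) →
        (∀ a ∈ A, 1 - δ < (Literature.Probability.LatticeModels.prodBernoulli w).real
            (Literature.Probability.Percolation.openConn a b)) →
        1 - ε < (Literature.Probability.LatticeModels.prodBernoulli w).real
            (Literature.Probability.Percolation.openConn o b) := by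
  intro hpb ε hε K
  have hK0 : (0 : ℝ) ≤ K := Nat.cast_nonneg K
  refine ⟨ε / ((K : ℝ) + 2), by positivity, ?_⟩
  intro n w A o b hK hoA hAb
  set δ : ℝ := ε / ((K : ℝ) + 2) with hδ
  have hδpos : 0 < δ := by positivity
  have hkey : δ * ((K : ℝ) + 2) = ε := by
    rw [hδ]; field_simp
  set μ := prodBernoulli w with hμ
  have hmeas : ∀ x y : Fin n, MeasurableSet (openConn x y : Set (Set (Sym2 (Fin n)))) :=
    fun x y => measurableSet_openConn_holds x y
  -- degenerate case `o ∈ A`: the second hypothesis at `a = o` already gives `μ(o ↔ b) > 1 - δ ≥ 1 - ε`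
  by_cases hoAmem : o ∈ A
  · have h1 := hAb o hoAmem
    have hδε : δ < ε := by
      rw [hδ]
      exact div_lt_self hε (by linarith)
    linarith
  -- hypotheses in complement form
  have hAc : μ.real (⋃ a ∈ A, openConn o a)ᶜ < δ := by
    rw [measureReal_compl (Finset.measurableSet_biUnion A fun a _ => hmeas o a), probReal_univ]
    linarith
  have hBc : ∀ a ∈ A, μ.real (openConn a b)ᶜ ≤ δ := by
    intro a ha
    rw [measureReal_compl (hmeas a b), probReal_univ]
    linarith [hAb a ha]
  -- the pocket bound with `t = δ`
  have hpock := hpb n w A o b δ hδpos.le hoAmem hBc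
  -- the pocket sum is at most `K δ`
  set F : Finset (Finset (Fin n)) :=
    (Finset.univ : Finset (Finset (Fin n))).filter (fun S₀ => o ∈ S₀ ∧ Disjoint S₀ A) with hF
  have hsum :=
    nearOneGluing_of_pocketSupport_sum_min_le F
      (fun S₀ => μ.real {ω | ∀ v : Fin n, ω ∈ openConnIn (↑A)ᶜ o v ↔ v ∈ S₀})
      (fun S₀ => μ.real {ω | ∀ v ∈ S₀, ω ∈ openConnIn ↑S₀ o v}) δ hδpos.le
      (fun _ => measureReal_nonneg) (fun _ => measureReal_le_one)
  have hcard :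
      (F.filter fun S₀ =>
          0 < μ.real {ω | ∀ v : Fin n, ω ∈ openConnIn (↑A)ᶜ o v ↔ v ∈ S₀}).card ≤ K := by
    refine le_trans (Finset.card_le_card ?_) hK
    intro S₀ hS
    simp only [hF, Finset.mem_filter, Finset.mem_univ, true_and] at hS ⊢
    exact ⟨hS.1.1, hS.1.2, hS.2⟩
  have hcardR :
      ((F.filter fun S₀ =>
          0 < μ.real {ω | ∀ v : Fin n, ω ∈ openConnIn (↑A)ᶜ o v ↔ v ∈ S₀}).card : ℝ) ≤ K := by
    exact_mod_cast hcard
  have h2 : μ.real ((⋃ a ∈ A, openConn o a) ∩ (openConn o b)ᶜ) ≤ (K : ℝ) * δ :=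
    hpock.trans (hsum.trans (mul_le_mul_of_nonneg_right hcardR hδpos.le))
  -- glue: `{o ↮ b} ⊆ {o ↮ A} ∪ ({o ↔ A} ∩ {o ↮ b})`
  have hcover : (openConn o b)ᶜ ⊆
      (⋃ a ∈ A, openConn o a)ᶜ ∪ ((⋃ a ∈ A, openConn o a) ∩ (openConn o b)ᶜ) := by
    intro ω hω
    by_cases h : ω ∈ ⋃ a ∈ A, openConn o a
    · exact Or.inr ⟨h, hω⟩
    · exact Or.inl h
  have hfin : μ.real (openConn o b)ᶜ < ε := by
    calc μ.real (openConn o b)ᶜ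
        ≤ μ.real ((⋃ a ∈ A, openConn o a)ᶜ ∪ ((⋃ a ∈ A, openConn o a) ∩ (openConn o b)ᶜ)) :=
          measureReal_mono hcover
      _ ≤ μ.real (⋃ a ∈ A, openConn o a)ᶜ + μ.real ((⋃ a ∈ A, openConn o a) ∩ (openConn o b)ᶜ) :=
          measureReal_union_le _ _
      _ < δ + (K : ℝ) * δ := by linarith
      _ ≤ ε := by nlinarith
  rw [measureReal_compl (hmeas o b), probReal_univ] at hfin
  linarith

end Summit.CriticalPhenomena.PercolationContinuityZ3.Theorems
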